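import Summits.SmoothPoincare4.SmoothPoincare4.Theses.CylinderEntropy
import Summits.SmoothPoincare4.SmoothPoincare4.Theorems.CylinderEntropyThinCrossSectionExistsLever
import Summits.SmoothPoincare4.SmoothPoincare4.Theorems.CylinderEntropyThinCrossSectionExistsSliceBallMass
import Summits.SmoothPoincare4.SmoothPoincare4.Theorems.ThinCrossSectionExists.Negative.FrameAnalysis
import HarnessLib

/-!
# `ThinCrossSectionExists` ⇐ `MassSlackIntr` ⇐ SPC4: the crux reduced to its ball-mass supply (line `ball-mass-slack`)

Crux E = `CylinderEntropy.ThinCrossSectionExists` (`stmt-SmoothPoincare4-7633`).  Line `ball-mass-slack` registered seven stubs;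
six are landed and proved (the lever `ballMass_cylEntropy_le_mul`: `λ_cyl(S) ≤ Λ·λ_cyl(slice)` for every `Λ`-subspherical
`S ⊆ N`, file `…ThinCrossSectionExistsLever`), and the seventh — the SUPPLY D = `stub_massSlackIntr`: every homotopy
4-sphere has a smooth end-separating cross-section embedding into `N = S⁴×ℝ` with `Λ`-subspherical intrinsic ball mass for
some `Λ < 4/e` — carries the crux.  This file records, kernel-checked, exactly where the crux now sits:

* `thinCrossSectionExists_of_massSlackIntr` — **E ⇐ D** given the `≤ 1` half `λ_cyl(slice) ≤ 1` of the route's support item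
  `SliceCalibration` (7634) (the line's composition `ThinCrossSectionExists_of` with all provable stubs discharged); and
  `thinCrossSectionExists_of_massSlackIntr_of_sliceCalibration` — the same with the item `SliceCalibration` by name;
* `massSlackIntr_of_spc4` — **D ⇐ SPC4**: the slice through a diffeomorphism `M ≅ S⁴` is a cross-section with `Λ = 1 < 4/e`
  (the landed `ballMass_slice_le`, p90628: the slice has `1`-subspherical ball mass from every centre of `N`);
* `nonempty_diffeomorph_of_ballMass` — **D-instance ∧ R ⇒ standard**: given the sibling crux `CylinderRungTwo` (R, 7631) and
  `λ_cyl(slice) ≤ 1`, a homotopy 4-sphere realised in `N` by a smooth end-separating embedding with `Λ`-subspherical ball mass,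
  `Λ < 4/e`, is diffeomorphic to `S⁴` — the only known way D implies SPC4 (costume yardstick of the refuter's
  `Negative.crux_of_spc4` / `crux_iff_spc4`).

So D is sandwiched `SPC4 ⇒ D ⇒ E` (given `λ_cyl(slice) ≤ 1`) and `D ∧ R ⇒ SPC4`: it is crux-sized (indeed crux-equivalent modulo
R and the calibration), which is the lead's `promote-stub` verdict.  Pure logic over landed files; no definitions, no facts.
-/

noncomputable section

open scoped BigOperators Topology Manifold MeasureTheory ENNReal NNReal ContDiff ContinuousMap
open Set Function MeasureTheory
open Literature.Geometry.Riemannian.SphericalCylinderEntropy (cylEntropy cylDensity cylKernel zonal)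
open Literature.Geometry.Manifold.CylinderSlice (sliceMap range_sliceMap isSmoothEmbedding_sliceMap sum_sq_sliceMap
  separatesEnds_of_slice_subset)

set_option linter.dupNamespace false

namespace Summit.SmoothPoincare4.SmoothPoincare4.Theorems.ThinCrossSectionExists.BallMassSlack

open Summit.SmoothPoincare4.SmoothPoincare4.Theses.CylinderEntropy (ThinCrossSectionExists CylinderRungTwo
  SliceCalibration)

/-- **E ⇐ D.**  The supply `MassSlackIntr` (stub D of line `ball-mass-slack`, inlined verbatim) implies the crux
`ThinCrossSectionExists`, given the `≤ 1` half of the slice calibration: D's own cross-section has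
`λ_cyl ≤ Λ·λ_cyl(slice) ≤ Λ < 4/e` by the lever. [folklore] -/
theorem thinCrossSectionExists_of_massSlackIntr :
    (∀ (M : Type) [TopologicalSpace M] [T2Space M] [SecondCountableTopology M]
      [ChartedSpace (EuclideanSpace ℝ (Fin 4)) M] [IsManifold (𝓡 4) ∞ M],
      M ≃ₕ (Metric.sphere (0 : EuclideanSpace ℝ (Fin 5)) 1) →
      ∃ ι : M → EuclideanSpace ℝ (Fin 6), Manifold.IsSmoothEmbedding (𝓡 4) (𝓡 6) ∞ ι ∧
        (∀ x, ∑ i : Fin 5, ι x (Fin.castSucc i) ^ 2 = 1) ∧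
        (∃ R : ℝ, ∀ a b : EuclideanSpace ℝ (Fin 6), ∑ i : Fin 5, a (Fin.castSucc i) ^ 2 = 1 → ∑ i : Fin 5, b (Fin.castSucc i) ^ 2 = 1 → a 5 ≤ -R → R ≤ b 5 →
          ¬ JoinedIn ({z : EuclideanSpace ℝ (Fin 6) | ∑ i : Fin 5, z (Fin.castSucc i) ^ 2 = 1} \ Set.range ι) a b) ∧
        ∃ Λ : ℝ≥0∞, Λ < ENNReal.ofReal (4 / Real.exp 1) ∧
          ∀ q : EuclideanSpace ℝ (Fin 6), ∑ i : Fin 5, q (Fin.castSucc i) ^ 2 = 1 → ∀ r : ℝ, 0 < r →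
          μH[4] (Set.range ι ∩ {y : EuclideanSpace ℝ (Fin 6) | ∑ i : Fin 5, y (Fin.castSucc i) ^ 2 = 1 ∧ Real.arccos (∑ i : Fin 5, y (Fin.castSucc i) * q (Fin.castSucc i)) ^ 2 + (y 5 - q 5) ^ 2 ≤ r ^ 2}) ≤
            Λ * μH[4] ({z : EuclideanSpace ℝ (Fin 6) | ∑ i : Fin 5, z (Fin.castSucc i) ^ 2 = 1 ∧ z 5 = 0} ∩
              {y : EuclideanSpace ℝ (Fin 6) | ∑ i : Fin 5, y (Fin.castSucc i) ^ 2 = 1 ∧ Real.arccos (∑ i : Fin 5, y (Fin.castSucc i) * (EuclideanSpace.single 0 1 : EuclideanSpace ℝ (Fin 6)) (Fin.castSucc i)) ^ 2 + (y 5 - (EuclideanSpace.single 0 1 : EuclideanSpace ℝ (Fin 6)) 5) ^ 2 ≤ r ^ 2})) →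
    cylEntropy {z : EuclideanSpace ℝ (Fin 6) | ∑ i : Fin 5, z (Fin.castSucc i) ^ 2 = 1 ∧ z 5 = 0} ≤ 1 →
    Summit.SmoothPoincare4.SmoothPoincare4.Theses.CylinderEntropy.ThinCrossSectionExists := by
  intro hD hcal M _ _ _ _ _ e
  obtain ⟨ι, hι, hN, hsep, Λ, hΛ, hmass⟩ := hD M e
  have hS : ∀ y ∈ Set.range ι, ∑ i : Fin 5, y (Fin.castSucc i) ^ 2 = 1 := by
    rintro _ ⟨x, rfl⟩
    exact hN x
  exact ⟨ι, hι, hN, hsep, lt_of_le_of_lt (ballMass_cylEntropy_le hcal hS hmass) hΛ⟩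

/-- **E ⇐ D ∧ `SliceCalibration`** (the route's support item 7634 by name; it is literally `λ_cyl(slice) = 1`). [folklore] -/
theorem thinCrossSectionExists_of_massSlackIntr_of_sliceCalibration
    (hD : ∀ (M : Type) [TopologicalSpace M] [T2Space M] [SecondCountableTopology M]
      [ChartedSpace (EuclideanSpace ℝ (Fin 4)) M] [IsManifold (𝓡 4) ∞ M],
      M ≃ₕ (Metric.sphere (0 : EuclideanSpace ℝ (Fin 5)) 1) →
      ∃ ι : M → EuclideanSpace ℝ (Fin 6), Manifold.IsSmoothEmbedding (𝓡 4) (𝓡 6) ∞ ι ∧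
        (∀ x, ∑ i : Fin 5, ι x (Fin.castSucc i) ^ 2 = 1) ∧
        (∃ R : ℝ, ∀ a b : EuclideanSpace ℝ (Fin 6), ∑ i : Fin 5, a (Fin.castSucc i) ^ 2 = 1 → ∑ i : Fin 5, b (Fin.castSucc i) ^ 2 = 1 → a 5 ≤ -R → R ≤ b 5 →
          ¬ JoinedIn ({z : EuclideanSpace ℝ (Fin 6) | ∑ i : Fin 5, z (Fin.castSucc i) ^ 2 = 1} \ Set.range ι) a b) ∧
        ∃ Λ : ℝ≥0∞, Λ < ENNReal.ofReal (4 / Real.exp 1) ∧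
          ∀ q : EuclideanSpace ℝ (Fin 6), ∑ i : Fin 5, q (Fin.castSucc i) ^ 2 = 1 → ∀ r : ℝ, 0 < r →
          μH[4] (Set.range ι ∩ {y : EuclideanSpace ℝ (Fin 6) | ∑ i : Fin 5, y (Fin.castSucc i) ^ 2 = 1 ∧ Real.arccos (∑ i : Fin 5, y (Fin.castSucc i) * q (Fin.castSucc i)) ^ 2 + (y 5 - q 5) ^ 2 ≤ r ^ 2}) ≤
            Λ * μH[4] ({z : EuclideanSpace ℝ (Fin 6) | ∑ i : Fin 5, z (Fin.castSucc i) ^ 2 = 1 ∧ z 5 = 0} ∩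
              {y : EuclideanSpace ℝ (Fin 6) | ∑ i : Fin 5, y (Fin.castSucc i) ^ 2 = 1 ∧ Real.arccos (∑ i : Fin 5, y (Fin.castSucc i) * (EuclideanSpace.single 0 1 : EuclideanSpace ℝ (Fin 6)) (Fin.castSucc i)) ^ 2 + (y 5 - (EuclideanSpace.single 0 1 : EuclideanSpace ℝ (Fin 6)) 5) ^ 2 ≤ r ^ 2}))
    (hcal : SliceCalibration) : ThinCrossSectionExists :=
  thinCrossSectionExists_of_massSlackIntr hD (le_of_eq hcal)

/-- **D ⇐ SPC4.**  If every homotopy 4-sphere is diffeomorphic to `S⁴`, the supply holds with `Λ = 1`: transport the unit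
slice along the diffeomorphism (`sliceMap 0 ∘ φ`, a smooth embedding onto `S⁴×{0}`, which separates the ends) and use that
the slice has `1`-subspherical intrinsic ball mass from every centre of `N` (`ballMass_slice_le`), `1 < 4/e`. [folklore] -/
theorem massSlackIntr_of_spc4 (h : _root_.SmoothPoincare4) :
    ∀ (M : Type) [TopologicalSpace M] [T2Space M] [SecondCountableTopology M]
      [ChartedSpace (EuclideanSpace ℝ (Fin 4)) M] [IsManifold (𝓡 4) ∞ M],
      M ≃ₕ (Metric.sphere (0 : EuclideanSpace ℝ (Fin 5)) 1) →
      ∃ ι : M → EuclideanSpace ℝ (Fin 6), Manifold.IsSmoothEmbedding (𝓡 4) (𝓡 6) ∞ ι ∧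
        (∀ x, ∑ i : Fin 5, ι x (Fin.castSucc i) ^ 2 = 1) ∧
        (∃ R : ℝ, ∀ a b : EuclideanSpace ℝ (Fin 6), ∑ i : Fin 5, a (Fin.castSucc i) ^ 2 = 1 → ∑ i : Fin 5, b (Fin.castSucc i) ^ 2 = 1 → a 5 ≤ -R → R ≤ b 5 →
          ¬ JoinedIn ({z : EuclideanSpace ℝ (Fin 6) | ∑ i : Fin 5, z (Fin.castSucc i) ^ 2 = 1} \ Set.range ι) a b) ∧
        ∃ Λ : ℝ≥0∞, Λ < ENNReal.ofReal (4 / Real.exp 1) ∧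
          ∀ q : EuclideanSpace ℝ (Fin 6), ∑ i : Fin 5, q (Fin.castSucc i) ^ 2 = 1 → ∀ r : ℝ, 0 < r →
          μH[4] (Set.range ι ∩ {y : EuclideanSpace ℝ (Fin 6) | ∑ i : Fin 5, y (Fin.castSucc i) ^ 2 = 1 ∧ Real.arccos (∑ i : Fin 5, y (Fin.castSucc i) * q (Fin.castSucc i)) ^ 2 + (y 5 - q 5) ^ 2 ≤ r ^ 2}) ≤
            Λ * μH[4] ({z : EuclideanSpace ℝ (Fin 6) | ∑ i : Fin 5, z (Fin.castSucc i) ^ 2 = 1 ∧ z 5 = 0} ∩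
              {y : EuclideanSpace ℝ (Fin 6) | ∑ i : Fin 5, y (Fin.castSucc i) ^ 2 = 1 ∧ Real.arccos (∑ i : Fin 5, y (Fin.castSucc i) * (EuclideanSpace.single 0 1 : EuclideanSpace ℝ (Fin 6)) (Fin.castSucc i)) ^ 2 + (y 5 - (EuclideanSpace.single 0 1 : EuclideanSpace ℝ (Fin 6)) 5) ^ 2 ≤ r ^ 2}) := by
  intro M _ _ _ _ _ e
  obtain ⟨φ⟩ := h M ‹ChartedSpace (EuclideanSpace ℝ (Fin 4)) M› ‹IsManifold (𝓡 4) ∞ M› e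
  have hr : Set.range (sliceMap 0 ∘ φ) = {z : EuclideanSpace ℝ (Fin 6) | ∑ i : Fin 5, z (Fin.castSucc i) ^ 2 = 1 ∧ z 5 = 0} := by
    rw [← range_sliceMap 0]
    ext z
    simp only [Set.mem_range, Function.comp_apply]
    constructor
    · rintro ⟨x, rfl⟩
      exact ⟨φ x, rfl⟩
    · rintro ⟨y, rfl⟩
      exact ⟨φ.symm y, by simp⟩
  refine ⟨sliceMap 0 ∘ φ, (isSmoothEmbedding_sliceMap 0).comp_diffeomorph φ, fun x => sum_sq_sliceMap 0 (φ x), ?_,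
    1, Negative.one_lt_level, ?_⟩
  · rw [hr]
    exact separatesEnds_of_slice_subset subset_rfl
  · intro q hq r hr0
    rw [hr, one_mul]
    exact ballMass_slice_le q hq r hr0

/-- **D-instance ∧ R ⇒ standard.**  Given the recognition crux R (`CylinderRungTwo`, item 7631) and `λ_cyl(slice) ≤ 1`: a
homotopy 4-sphere realised in `N` by a smooth end-separating embedding whose image has `Λ`-subspherical intrinsic ball mass
for some `Λ < 4/e` is diffeomorphic to `S⁴` (lever + R).  The only known route from D to SPC4. [folklore] -/
theorem nonempty_diffeomorph_of_ballMass (hR : CylinderRungTwo)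
    (hcal : cylEntropy {z : EuclideanSpace ℝ (Fin 6) | ∑ i : Fin 5, z (Fin.castSucc i) ^ 2 = 1 ∧ z 5 = 0} ≤ 1)
    (M : Type) [TopologicalSpace M] [T2Space M] [SecondCountableTopology M]
    [ChartedSpace (EuclideanSpace ℝ (Fin 4)) M] [IsManifold (𝓡 4) ∞ M]
    (e : M ≃ₕ (Metric.sphere (0 : EuclideanSpace ℝ (Fin 5)) 1))
    (ι : M → EuclideanSpace ℝ (Fin 6)) (hι : Manifold.IsSmoothEmbedding (𝓡 4) (𝓡 6) ∞ ι)
    (hN : ∀ x, ∑ i : Fin 5, ι x (Fin.castSucc i) ^ 2 = 1)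
    (hsep : ∃ R : ℝ, ∀ a b : EuclideanSpace ℝ (Fin 6), ∑ i : Fin 5, a (Fin.castSucc i) ^ 2 = 1 → ∑ i : Fin 5, b (Fin.castSucc i) ^ 2 = 1 → a 5 ≤ -R → R ≤ b 5 →
      ¬ JoinedIn ({z : EuclideanSpace ℝ (Fin 6) | ∑ i : Fin 5, z (Fin.castSucc i) ^ 2 = 1} \ Set.range ι) a b)
    {Λ : ℝ≥0∞} (hΛ : Λ < ENNReal.ofReal (4 / Real.exp 1))
    (hmass : ∀ q : EuclideanSpace ℝ (Fin 6), ∑ i : Fin 5, q (Fin.castSucc i) ^ 2 = 1 → ∀ r : ℝ, 0 < r →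
      μH[4] (Set.range ι ∩ {y : EuclideanSpace ℝ (Fin 6) | ∑ i : Fin 5, y (Fin.castSucc i) ^ 2 = 1 ∧ Real.arccos (∑ i : Fin 5, y (Fin.castSucc i) * q (Fin.castSucc i)) ^ 2 + (y 5 - q 5) ^ 2 ≤ r ^ 2}) ≤
        Λ * μH[4] ({z : EuclideanSpace ℝ (Fin 6) | ∑ i : Fin 5, z (Fin.castSucc i) ^ 2 = 1 ∧ z 5 = 0} ∩
          {y : EuclideanSpace ℝ (Fin 6) | ∑ i : Fin 5, y (Fin.castSucc i) ^ 2 = 1 ∧ Real.arccos (∑ i : Fin 5, y (Fin.castSucc i) * (EuclideanSpace.single 0 1 : EuclideanSpace ℝ (Fin 6)) (Fin.castSucc i)) ^ 2 + (y 5 - (EuclideanSpace.single 0 1 : EuclideanSpace ℝ (Fin 6)) 5) ^ 2 ≤ r ^ 2})) :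
    Nonempty (M ≃ₘ⟮𝓡 4, 𝓡 4⟯ (Metric.sphere (0 : EuclideanSpace ℝ (Fin 5)) 1)) := by
  have hS : ∀ y ∈ Set.range ι, ∑ i : Fin 5, y (Fin.castSucc i) ^ 2 = 1 := by
    rintro _ ⟨x, rfl⟩
    exact hN x
  exact hR M e ι hι hN hsep (lt_of_le_of_lt (ballMass_cylEntropy_le hcal hS hmass) hΛ)

end Summit.SmoothPoincare4.SmoothPoincare4.Theorems.ThinCrossSectionExists.BallMassSlack

end
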